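import Summits.QuantumFields.YangMills.Theorems.UnitScaleTiltProp7SectET3RealityPInvJTermT3
import Literature.MathematicalPhysics.QuantumFieldTheory.Balaban1983to89.T3PrintedMinimiserExistence
import HarnessLib

/-!
# Route `UnitScaleTilt`, crux «MinimiserStabilityRegPr» (stmt-QuantumFields-19200, stub EX), node N06(d = 3), route (α) — **THE `L²` (FORM) BOUND OF PRINT'S J-TERM
# `T_Jᴾ(U₀)` FROM ITS SUP-ROW, BY SYMMETRY**: a symmetric operator whose coordinate sup-norm is bounded by `k` has all eigenvalues in `[−k, k]`, hence
# `‖⟨u, T v⟩‖ ≤ k‖u‖‖v‖` — so the EX display's former sup-row `hTJ` ([Balaban1985BackgroundPropagators] (3.127)∕(3.137); a corollary of `h133` ∧ `hC157` by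
# ★px13's ✓`hTJ_of_hHcol_h157`) already supplies the `τ`-row that ✓`Prop7CoerciveRawSlotOfGaugeFixedLift.hPosΔ_lift_of_gaugeFixedRow` asks for

Cell `ym3-torus` (HUMAN RULING D-0037, YM ladder rung R3 — YM₃ on T³ is a RUNG, NOT d = 4, NOT the Clay problem; the YM mass gap is NOT proved).  Fleet lead seat
`ym-ust-19200-p1` (gen 22), positivity-block lane of the EX face; sequel of ✓`Prop7CoerciveOfGaugeFixedLift` ∕ ✓`Prop7PureGaugeCurlCurvature` ∕
✓`Prop7CoerciveRawSlotOfGaugeFixedLift` (same seat).  THEOREMS ONLY (0 `def`, 0 `sorry`); `--supports stmt-QuantumFields-19200 --as helper`; count-neutral.  Composes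
Mathlib's spectral theorem for symmetric operators (`LinearMap.IsSymmetric.eigenvectorBasis`) with ✓`Prop7SectET3RealityPInvJTerm.TJP_rows_at_regPr` (★w-lineage: `T_Jᴾ(U₀)`
IS symmetric at `U₀ ∈ 𝔘_k(ε₀)`).  Nothing of [B9] §3 at a curved background is asserted.

THE PRINT.  [Balaban1985BackgroundPropagators] p. 421 (3.127): *«⟨A, Δ₁A⟩ = ⟨A, ΔA⟩ − 2⟨HC⁽²⁾(A), J⟩ … they are small because the configuration J is small»*; p. 423
(3.137) (the sup bound of the J-term operators); [Balaban1985Variational] (28) p. 282 `|J| ≤ C₁B₃ε₁`.  The step «sup-row ⟹ form bound» is [folklore] (spectral radius ≤ any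
operator norm, for a self-adjoint operator = the `L²` norm).

WHAT IS PROVED (ns `…Theorems.Prop7TJL2BoundOfSupRow`).
* §1 (Mathlib only) ★ `inner_le_of_isSymmetric_of_eigenvalue_bound` — finite-dimensional complex inner-product space, `T` symmetric, every eigenvalue `μ` (real, with a
  non-zero eigenvector) has `|μ| ≤ k`, `0 ≤ k` ⟹ `∀ u w, ‖⟨u, T w⟩‖ ≤ k‖u‖‖w‖`; ★ `eigenvalue_bound_of_supRow` — a coordinate reading `φ : E ≃ₗ (ι → V)` (`ι` finite, non-empty,
  `V` normed) and the sup-row `∀ x s, (∀ b, ‖φ x b‖ ≤ s) → ∀ b, ‖φ (T x) b‖ ≤ k·s` ⟹ every eigenvalue has `|μ| ≤ k`; ★★ `inner_le_of_isSymmetric_of_supRow` (the two composed).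
* §2 (member) ★★★ `tauRow_TJP_of_supRow` — `U₀ ∈ 𝔘_k(ε₀)` (`RegPr`, `10¹²L³ε₀ ≤ 1`), `0 ≤ a`, and the sup-row of `T_Jᴾ(U₀)` in the EX display's letters
  (`∀ X s, (∀ bd, ‖X bd‖ ≤ s) → ∀ bd, ‖(toL2⁻¹ (T_Jᴾ(U₀) (toL2 X))) bd‖ ≤ k·s`) ⟹ `∀ u v, ‖⟨u, TJSlotP … U₀ v⟩‖ ≤ k‖u‖‖v‖` — the `hT`∕`hTJ` hypothesis of
  ✓`coercive_laplaceA_rawSlot_of_gaugeFixed_of_lift` ∕ ✓`hPosΔ_lift_of_gaugeFixedRow` with `τ := k`.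
* §3 (family) ★★ `hTJtau_of_hTJsup` — the S23ᴸ-shaped sup-row `hTJ` at radius `αcap L` (window `10¹²L³·αcap L ≤ 1`) gives the `τ`-row of ✓`hPosΔ_lift_of_gaugeFixedRow` on
  `RegPr ρ U₀`, `ρ ≤ αcap L`, with `τ L i := kTJ L`.
EFFECT (numbers, not adjectives): with this file, ✓`hPosΔ_lift_of_gaugeFixedRow`'s inputs are {`hLiftRec`, the γ-row, the sup-row `hTJ` (itself ⟸ `h133` ∧ `hC157` by
★px13 ✓`Prop7TJRowOfEntry157.hTJ_of_hHcol_h157`), numeric windows}: behind `Lift`, the three positivity rows of the EX face cost ONE new analytic row (γ) beyond rows the face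
already carries.
HONEST SCOPE.  Linear algebra; no estimate of print is proved; `hPosΔ`, the other print rows, `hThm2S`, EX, the crux are NOT proved; nothing continuum ∕ OS ∕ mass-gap ∕ Clay.

References: T. Bałaban, CMP **99** (1985) 389–434 [Balaban1985BackgroundPropagators] ((3.127)–(3.128) p.421, (3.137) p.423, Thm 3.11 p.416); CMP **102** (1985) 277–309
[Balaban1985Variational] ((28) p.282, (141)–(142) p.299).
-/

set_option autoImplicit false

noncomputable section

open scoped InnerProductSpace ComplexConjugate Matrix.Norms.L2Operator BigOperators

namespace Summit.QuantumFields.YangMills.Theorems.Prop7TJL2BoundOfSupRow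

/-! ## §1 Symmetric operators: eigenvalue bound ⟹ form bound; sup-row ⟹ eigenvalue bound -/

section Abstract

variable {E : Type*} [NormedAddCommGroup E] [InnerProductSpace ℂ E] [FiniteDimensional ℂ E]

/-- ★ **EIGENVALUE BOUND ⟹ FORM BOUND** for a symmetric operator on a finite-dimensional complex inner-product space: if every real `μ` admitting a non-zero `v` with
`T v = μ•v` has `|μ| ≤ k` (`0 ≤ k`), then `‖⟨u, T w⟩‖ ≤ k·‖u‖·‖w‖` (expand in an orthonormal eigenbasis, Cauchy–Schwarz, Parseval). [folklore] -/
theorem inner_le_of_isSymmetric_of_eigenvalue_bound (T : E →ₗ[ℂ] E) (hT : T.IsSymmetric) {k : ℝ} (hk : 0 ≤ k)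
    (hev : ∀ (μ : ℝ) (v : E), v ≠ 0 → T v = (μ : ℂ) • v → |μ| ≤ k) (u w : E) :
    ‖⟪u, T w⟫_ℂ‖ ≤ k * ‖u‖ * ‖w‖ := by
  have hn : Module.finrank ℂ E = Module.finrank ℂ E := rfl
  -- eigenvalues are bounded by `k`
  have hμ : ∀ i, |hT.eigenvalues hn i| ≤ k := fun i =>
    hev _ (hT.eigenvectorBasis hn i) ((hT.eigenvectorBasis hn).orthonormal.ne_zero i) (hT.apply_eigenvectorBasis hn i)
  -- `⟪u, T w⟫ = Σ_i ⟪u, b i⟫ ⟪b i, T w⟫` and `‖⟪b i, T w⟫‖ = |λ_i|·‖⟪b i, w⟫‖`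
  have hterm : ∀ i, ‖⟪u, hT.eigenvectorBasis hn i⟫_ℂ * ⟪hT.eigenvectorBasis hn i, T w⟫_ℂ‖
      ≤ k * (‖⟪u, hT.eigenvectorBasis hn i⟫_ℂ‖ * ‖⟪hT.eigenvectorBasis hn i, w⟫_ℂ‖) := by
    intro i
    rw [← hT (hT.eigenvectorBasis hn i) w, hT.apply_eigenvectorBasis hn i, inner_smul_left, norm_mul, norm_mul, RCLike.norm_conj,
      RCLike.norm_ofReal]
    calc ‖⟪u, hT.eigenvectorBasis hn i⟫_ℂ‖ * (|hT.eigenvalues hn i| * ‖⟪hT.eigenvectorBasis hn i, w⟫_ℂ‖)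
        = |hT.eigenvalues hn i| * (‖⟪u, hT.eigenvectorBasis hn i⟫_ℂ‖ * ‖⟪hT.eigenvectorBasis hn i, w⟫_ℂ‖) := by ring
      _ ≤ k * (‖⟪u, hT.eigenvectorBasis hn i⟫_ℂ‖ * ‖⟪hT.eigenvectorBasis hn i, w⟫_ℂ‖) := mul_le_mul_of_nonneg_right (hμ i) (by positivity)
  rw [← (hT.eigenvectorBasis hn).sum_inner_mul_inner u (T w)]
  -- triangle inequality, Cauchy–Schwarz, Parseval
  have h1 : ‖∑ i, ⟪u, hT.eigenvectorBasis hn i⟫_ℂ * ⟪hT.eigenvectorBasis hn i, T w⟫_ℂ‖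
      ≤ ∑ i, k * (‖⟪u, hT.eigenvectorBasis hn i⟫_ℂ‖ * ‖⟪hT.eigenvectorBasis hn i, w⟫_ℂ‖) :=
    (norm_sum_le _ _).trans (Finset.sum_le_sum fun i _ => hterm i)
  have h2 : ∑ i, ‖⟪u, hT.eigenvectorBasis hn i⟫_ℂ‖ * ‖⟪hT.eigenvectorBasis hn i, w⟫_ℂ‖ ≤ ‖u‖ * ‖w‖ := by
    have hcs := Finset.sum_mul_sq_le_sq_mul_sq Finset.univ (fun i => ‖⟪u, hT.eigenvectorBasis hn i⟫_ℂ‖) (fun i => ‖⟪hT.eigenvectorBasis hn i, w⟫_ℂ‖)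
    rw [(hT.eigenvectorBasis hn).sum_sq_norm_inner_left u, (hT.eigenvectorBasis hn).sum_sq_norm_inner_right w] at hcs
    have h0 : 0 ≤ ∑ i, ‖⟪u, hT.eigenvectorBasis hn i⟫_ℂ‖ * ‖⟪hT.eigenvectorBasis hn i, w⟫_ℂ‖ := Finset.sum_nonneg fun i _ => by positivity
    nlinarith [norm_nonneg u, norm_nonneg w, mul_nonneg (norm_nonneg u) (norm_nonneg w)]
  calc ‖∑ i, ⟪u, hT.eigenvectorBasis hn i⟫_ℂ * ⟪hT.eigenvectorBasis hn i, T w⟫_ℂ‖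
      ≤ ∑ i, k * (‖⟪u, hT.eigenvectorBasis hn i⟫_ℂ‖ * ‖⟪hT.eigenvectorBasis hn i, w⟫_ℂ‖) := h1
    _ = k * ∑ i, ‖⟪u, hT.eigenvectorBasis hn i⟫_ℂ‖ * ‖⟪hT.eigenvectorBasis hn i, w⟫_ℂ‖ := by rw [Finset.mul_sum]
    _ ≤ k * (‖u‖ * ‖w‖) := mul_le_mul_of_nonneg_left h2 hk
    _ = k * ‖u‖ * ‖w‖ := by ring

omit [FiniteDimensional ℂ E] in
/-- ★ **SUP-ROW ⟹ EIGENVALUE BOUND**: read `E` in coordinates `φ : E ≃ₗ (ι → V)` (`ι` finite, `V` normed); if `‖φ(Tx) b‖ ≤ k·s` whenever `‖φ x b′‖ ≤ s` for all `b′`, then every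
eigenvalue `μ` of `T` (with a non-zero eigenvector) has `|μ| ≤ k` (test the row at the eigenvector, at the coordinate where `‖φ v ·‖` is largest). [folklore] -/
theorem eigenvalue_bound_of_supRow {ι : Type*} [Fintype ι] {V : Type*} [NormedAddCommGroup V] [NormedSpace ℂ V]
    (T : E →ₗ[ℂ] E) (φ : E ≃ₗ[ℂ] (ι → V)) {k : ℝ}
    (hrow : ∀ (x : E) (s : ℝ), (∀ b, ‖φ x b‖ ≤ s) → ∀ b, ‖φ (T x) b‖ ≤ k * s) :
    ∀ (μ : ℝ) (v : E), v ≠ 0 → T v = (μ : ℂ) • v → |μ| ≤ k := by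
  intro μ v hv hTv
  -- a coordinate where `‖φ v ·‖` is maximal, and it is positive
  have hφv : φ v ≠ 0 := fun h0 => hv (φ.map_eq_zero_iff.1 h0)
  obtain ⟨b₁, hb₁⟩ : ∃ b, φ v b ≠ 0 := by
    by_contra hall
    exact hφv (funext fun b => by by_contra hb; exact hall ⟨b, hb⟩)
  haveI : Nonempty ι := ⟨b₁⟩
  obtain ⟨b₀, hb₀⟩ := Finite.exists_max fun b => ‖φ v b‖
  have hs : 0 < ‖φ v b₀‖ := lt_of_lt_of_le (norm_pos_iff.2 hb₁) (hb₀ b₁)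
  have h1 := hrow v ‖φ v b₀‖ hb₀ b₀
  rw [hTv, map_smul, Pi.smul_apply, norm_smul, Complex.norm_real, Real.norm_eq_abs] at h1
  exact le_of_mul_le_mul_right h1 hs

/-- ★★ **SUP-ROW ⟹ FORM BOUND FOR A SYMMETRIC OPERATOR** (§1 composed): `0 ≤ k`, `T` symmetric, the coordinate sup-row ⟹ `‖⟨u, T w⟩‖ ≤ k‖u‖‖w‖`. [folklore] -/
theorem inner_le_of_isSymmetric_of_supRow {ι : Type*} [Fintype ι] {V : Type*} [NormedAddCommGroup V] [NormedSpace ℂ V]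
    (T : E →ₗ[ℂ] E) (hT : T.IsSymmetric) (φ : E ≃ₗ[ℂ] (ι → V)) {k : ℝ} (hk : 0 ≤ k)
    (hrow : ∀ (x : E) (s : ℝ), (∀ b, ‖φ x b‖ ≤ s) → ∀ b, ‖φ (T x) b‖ ≤ k * s) (u w : E) :
    ‖⟪u, T w⟫_ℂ‖ ≤ k * ‖u‖ * ‖w‖ :=
  inner_le_of_isSymmetric_of_eigenvalue_bound T hT hk (eigenvalue_bound_of_supRow T φ hrow) u w

end Abstract

/-! ## §2 Member: the `τ`-row of `T_Jᴾ(U₀)` at `U₀ ∈ 𝔘_k(ε₀)` from its sup-row -/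

section Member

open Literature.MathematicalPhysics.QuantumFieldTheory.Balaban1983to89
open Literature.MathematicalPhysics.QuantumFieldTheory.Balaban1983to89.T3ContinuumYM3Torus
open Literature.MathematicalPhysics.QuantumFieldTheory.Balaban1983to89.T3PrintedRegularMinimiser (RegPr)
open T3SectALandauChart (eta eta_pos)
open B11Eq103H1Complex (BondL2K)
open Summit.QuantumFields.YangMills.Theorems.Prop7SectET3Transport (periodsT3)
open Summit.QuantumFields.YangMills.Theorems.Prop7SectET3HilbertLetters (W₂ toL2)
open Summit.QuantumFields.YangMills.Theorems.Prop7SectET3DeltaOnePInv (TJP TJSlotP TJSlotP_apply)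
open Summit.QuantumFields.YangMills.Theorems.Prop7SectET3RealityPInvJTerm (TJP_rows_at_regPr)

variable (F : T3Family) {n K : ℕ} (h : n ≤ K) {c₀ cB a : ℝ} [Fact (0 < c₀)] [Fact (0 < cB)]

/-- ★★★ **THE `τ`-ROW OF PRINT'S J-TERM FROM ITS SUP-ROW, AT `U₀ ∈ 𝔘_k(ε₀)`** (`RegPr`, `10¹²L³ε₀ ≤ 1`, `0 ≤ a`, `0 ≤ k`): the EX display's sup-row
`∀ X s, (∀ bd, ‖X bd‖ ≤ s) → ∀ bd, ‖(toL2⁻¹(T_Jᴾ(U₀)(toL2 X))) bd‖ ≤ k·s` gives `‖⟨u, T_J(U₀) v⟩‖ ≤ k‖u‖‖v‖` for all `u v` — `T_Jᴾ(U₀)` is symmetric there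
(✓`TJP_rows_at_regPr`, windows `10⁹L²e ≤ 1` at `e := (10⁹L²)⁻¹` and `10¹²L³ε₀ ≤ 1`), so §1 applies in the coordinates `toL2⁻¹`.
[cite: Balaban1985BackgroundPropagators, (3.127)–(3.128) p.421, (3.137) p.423] -/
theorem tauRow_TJP_of_supRow {ε₀ : ℝ} (hε₀ : 0 < ε₀) (hWε : 10 ^ 12 * (F.L : ℝ) ^ 3 * ε₀ ≤ 1) (ha : 0 ≤ a)
    (U₀ : GaugeField (F.P K) 0 (Matrix.specialUnitaryGroup (Fin 2) ℂ)) (hreg : RegPr F n K ε₀ U₀) {k : ℝ} (hk : 0 ≤ k)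
    (hrow : ∀ (X : PBond (F.P K) 0 → Matrix (Fin 2) (Fin 2) ℂ) (s : ℝ), (∀ bd, ‖X bd‖ ≤ s) →
      ∀ bd : PBond (F.P K) 0, ‖(toL2 F K c₀).symm (TJSlotP F n K h c₀ cB a U₀ (toL2 F K c₀ X)) bd‖ ≤ k * s) :
    ∀ u v : BondL2K ℂ 3 (periodsT3 F K) c₀ W₂, ‖⟪u, TJSlotP F n K h c₀ cB a U₀ v⟫_ℂ‖ ≤ k * ‖u‖ * ‖v‖ := by
  have hL1 : (1 : ℝ) < (F.L : ℝ) := by exact_mod_cast F.hL.2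
  have hL : (0 : ℝ) < (F.L : ℝ) := lt_trans zero_lt_one hL1
  haveI : Fact (0 < (F.L : ℝ)) := ⟨hL⟩
  haveI : Fact (0 < ((F.L : ℝ)⁻¹) ^ (K - n)) := ⟨pow_pos (inv_pos.2 hL) _⟩
  -- the symmetry of `T_Jᴾ(U₀)` on the printed-regular class
  have he : (0 : ℝ) < (10 ^ 9 * (F.L : ℝ) ^ 2)⁻¹ := by positivity
  have hWe : 10 ^ 9 * (F.L : ℝ) ^ 2 * (10 ^ 9 * (F.L : ℝ) ^ 2)⁻¹ ≤ 1 := by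
    rw [mul_inv_cancel₀ (by positivity)]
  have hsymm := (TJP_rows_at_regPr F n K h c₀ cB a U₀ ha hε₀ he hWe hWε hreg).2.2
  -- §1 in the coordinates `toL2⁻¹`
  intro u v
  have hrow' : ∀ (x : BondL2K ℂ 3 (periodsT3 F K) c₀ W₂) (s : ℝ), (∀ b, ‖(toL2 F K c₀).symm x b‖ ≤ s) →
      ∀ b, ‖(toL2 F K c₀).symm (((TJP F n K h c₀ cB a U₀ : BondL2K ℂ 3 (periodsT3 F K) c₀ W₂ →L[ℂ] BondL2K ℂ 3 (periodsT3 F K) c₀ W₂) :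
        BondL2K ℂ 3 (periodsT3 F K) c₀ W₂ →ₗ[ℂ] BondL2K ℂ 3 (periodsT3 F K) c₀ W₂) x) b‖ ≤ k * s := by
    intro x s hx b
    have h1 := hrow ((toL2 F K c₀).symm x) s hx b
    rw [LinearEquiv.apply_symm_apply, TJSlotP_apply] at h1
    exact h1
  have h2 := inner_le_of_isSymmetric_of_supRow _ hsymm (toL2 F K c₀).symm hk hrow' u v
  rw [TJSlotP_apply]
  exact h2

end Member

/-! ## §3 Family: the `τ`-row of ✓`hPosΔ_lift_of_gaugeFixedRow` from the S23ᴸ-shaped sup-row `hTJ` -/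

section Family

open Literature.MathematicalPhysics.QuantumFieldTheory.Balaban1983to89
open Literature.MathematicalPhysics.QuantumFieldTheory.Balaban1983to89.T3ContinuumYM3Torus
open Literature.MathematicalPhysics.QuantumFieldTheory.Balaban1983to89.T3PrintedRegularMinimiser (RegPr)
open Literature.MathematicalPhysics.QuantumFieldTheory.Balaban1983to89.T3Thm1Carrier (Idx)
open B11Eq103H1Complex (BondL2K)
open Summit.QuantumFields.YangMills.Theorems.Prop7SectET3Transport (periodsT3)
open Summit.QuantumFields.YangMills.Theorems.Prop7SectET3HilbertLetters (W₂ toL2)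
open Summit.QuantumFields.YangMills.Theorems.Prop7SectET3DeltaOnePInv (TJSlotP)

/-- ★★ **THE `τ`-ROW OF ✓`hPosΔ_lift_of_gaugeFixedRow` FROM THE SUP-ROW `hTJ` OF THE EX FACE** (its S23ᴸ text, read at the radius `αcap L`; ★px13 ✓`hTJ_of_hHcol_h157` derives
that row from `h133` ∧ `hC157`): in the window `10¹²·L³·αcap L ≤ 1`, for `0 ≤ kTJ L`, on every `RegPr ρ U₀` with `ρ ≤ αcap L`:
`‖⟨u, TJSlotP … U₀ v⟩‖ ≤ kTJ L·‖u‖·‖v‖`. [cite: Balaban1985BackgroundPropagators, (3.127)–(3.128) p.421, (3.137) p.423] -/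
theorem hTJtau_of_hTJsup (αcap : ℕ → ℝ) (hαcap : ∀ L : ℕ, 1 < L → 0 < αcap L) (hαW : ∀ L : ℕ, 1 < L → 10 ^ 12 * (L : ℝ) ^ 3 * αcap L ≤ 1)
    (c₀ cB : ℕ → ℝ) [hc₀ : ∀ L : ℕ, Fact (0 < c₀ L)] [hcB : ∀ L : ℕ, Fact (0 < cB L)]
    (a : ∀ L : ℕ, Idx L → ℝ) (ha : ∀ (L : ℕ) (i : Idx L), 0 < a L i)
    (kTJ : ℕ → ℝ) (hkTJ : ∀ L : ℕ, 1 < L → 0 ≤ kTJ L)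
    (hTJ : ∀ (L : ℕ), 1 < L → ∀ (i : Idx L) (U₀ : GaugeField (i.1.1.P i.1.2.2) 0 (Matrix.specialUnitaryGroup (Fin 2) ℂ)), RegPr i.1.1 i.1.2.1 i.1.2.2 (αcap L) U₀ →
      ∀ (X : PBond (i.1.1.P i.1.2.2) 0 → Matrix (Fin 2) (Fin 2) ℂ) (s : ℝ), (∀ bd, ‖X bd‖ ≤ s) →
        ∀ bd : PBond (i.1.1.P i.1.2.2) 0, ‖(toL2 i.1.1 i.1.2.2 (c₀ L)).symm (TJSlotP i.1.1 i.1.2.1 i.1.2.2 i.2.2.le (c₀ L) (cB L) (a L i) U₀ (toL2 i.1.1 i.1.2.2 (c₀ L) X)) bd‖ ≤ kTJ L * s) :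
    ∀ (L : ℕ), 1 < L → ∀ (i : Idx L) (U₀ : GaugeField (i.1.1.P i.1.2.2) 0 (Matrix.specialUnitaryGroup (Fin 2) ℂ)), ∀ ρ : ℝ,
      RegPr i.1.1 i.1.2.1 i.1.2.2 ρ U₀ → ρ ≤ αcap L →
        ∀ u v : BondL2K ℂ 3 (periodsT3 i.1.1 i.1.2.2) (c₀ L) W₂,
          ‖⟪u, TJSlotP i.1.1 i.1.2.1 i.1.2.2 i.2.2.le (c₀ L) (cB L) (a L i) U₀ v⟫_ℂ‖ ≤ kTJ L * ‖u‖ * ‖v‖ := by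
  intro L hL i U₀ ρ hreg hρ u v
  have hreg' : RegPr i.1.1 i.1.2.1 i.1.2.2 (αcap L) U₀ := T3PrintedMinimiserExistence.regPr_mono i.1.1 hρ hreg
  have hW : 10 ^ 12 * (i.1.1.L : ℝ) ^ 3 * αcap L ≤ 1 := by rw [i.2.1]; exact hαW L hL
  exact tauRow_TJP_of_supRow i.1.1 i.2.2.le (hαcap L hL) hW (ha L i).le U₀ hreg' (hkTJ L hL) (hTJ L hL i U₀ hreg') u v

end Family

end Summit.QuantumFields.YangMills.Theorems.Prop7TJL2BoundOfSupRow

end
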